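import Mathlib
import Summits.Ventures.PercRepro2.Defs
import Summits.Ventures.PercRepro2.Harris
import Summits.Ventures.PercRepro2.CoinDefs
import Summits.Ventures.PercRepro2.CoinReverse
import Summits.Ventures.PercRepro2.CoinStarDefs
import Summits.Ventures.PercRepro2.CoinLsmCoreDefs
import Summits.Ventures.PercRepro2.CoinLsmCoreU
import Summits.Ventures.PercRepro2.CoinCoreGate
import Summits.Ventures.PercRepro2.CoinOrTailAlg
import Summits.Ventures.PercRepro2.CoinOrTailBlockSums
import Summits.Ventures.PercRepro2.CoinBlockTheoremII

/-!
# Row 2′DARC over a log-supermodular core whose free arc starts at a SURE vertex, for ANY two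
markers, at every head (blind cell PercRepro2, night-2 g10; proofs/NIGHT2-DARC.md §40.7)

`darc_of_lsmCoreSure`: a closed-in core `C` (pairs at the root allowed) with a log-supermodular
cluster law (`hν`, all pairs), the free arc `u → w` with `u ∈ C` a SURE vertex of the core —
every cluster of positive probability contains `u` (`hsure`) — and ANY two markers `a, b ∈ C`:
`Φ_D({s ↛ t in D + (u → w)}) ≥ 0` at every head, for every probability vector, with NO
non-degeneracy hypothesis.  This is exactly the case `M₀ = 0` (the `u`-absent cell empty)
excluded by the positivity hypotheses of g7's `darc_of_uCellLsmU` (§30.11/30.15).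

Mechanism: with `u` sure the gate head value is `G W = A (insert w W)` on every cluster that
counts, so the five «gate weight increasing» block inequalities `G1`–`G5` and the
log-supermodularity of the two block systems are single Ahlswede–Daykin steps
(`cellBlock_mul_le`), and Block theorem II (`blockII_nonneg`, the tilt identity) closes.
-/

namespace Summit.Ventures.PercRepro2.Coin

open Classical

section CellBlock

variable {V : Type*} [DecidableEq V] {R : Type*} [Field R] [LinearOrder R] [IsStrictOrderedRing R]

/-- **The generic Ahlswede–Daykin step on marker blocks**: four nonnegative weights with the
pointwise lattice condition give the block-sum inequality for any two marker patterns. -/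
theorem cellBlock_mul_le (U : Finset V) (F₁ F₂ F₃ F₄ : Finset V → R) (m₁ m₂ : V)
    (b₁ b₂ b₁' b₂' : Bool) (h₁ : ∀ W, 0 ≤ F₁ W) (h₂ : ∀ W, 0 ≤ F₂ W) (h₃ : ∀ W, 0 ≤ F₃ W)
    (h₄ : ∀ W, 0 ≤ F₄ W)
    (h : ∀ s ⊆ U, ∀ t ⊆ U, F₁ s * F₂ t ≤ F₃ (s ∩ t) * F₄ (s ∪ t)) :
    (∑ W ∈ U.powerset, F₁ W * cellWt m₁ m₂ b₁ b₂ W) *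
        (∑ W ∈ U.powerset, F₂ W * cellWt m₁ m₂ b₁' b₂' W) ≤
      (∑ W ∈ U.powerset, F₃ W * cellWt m₁ m₂ (b₁ && b₁') (b₂ && b₂') W) *
        (∑ W ∈ U.powerset, F₄ W * cellWt m₁ m₂ (b₁ || b₁') (b₂ || b₂') W) := by
  have g₁ : (0 : Finset V → R) ≤ fun W => F₁ W * cellWt m₁ m₂ b₁ b₂ W :=
    fun W => mul_nonneg (h₁ W) (cellWt_nonneg _ _ _ _ _)
  have g₂ : (0 : Finset V → R) ≤ fun W => F₂ W * cellWt m₁ m₂ b₁' b₂' W :=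
    fun W => mul_nonneg (h₂ W) (cellWt_nonneg _ _ _ _ _)
  have g₃ : (0 : Finset V → R) ≤ fun W => F₃ W * cellWt m₁ m₂ (b₁ && b₁') (b₂ && b₂') W :=
    fun W => mul_nonneg (h₃ W) (cellWt_nonneg _ _ _ _ _)
  have g₄ : (0 : Finset V → R) ≤ fun W => F₄ W * cellWt m₁ m₂ (b₁ || b₁') (b₂ || b₂') W :=
    fun W => mul_nonneg (h₄ W) (cellWt_nonneg _ _ _ _ _)
  have hh : ∀ ⦃s : Finset V⦄, s ⊆ U → ∀ ⦃t : Finset V⦄, t ⊆ U →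
      (fun W => F₁ W * cellWt m₁ m₂ b₁ b₂ W) s * (fun W => F₂ W * cellWt m₁ m₂ b₁' b₂' W) t ≤
      (fun W => F₃ W * cellWt m₁ m₂ (b₁ && b₁') (b₂ && b₂') W) (s ∩ t) *
        (fun W => F₄ W * cellWt m₁ m₂ (b₁ || b₁') (b₂ || b₂') W) (s ∪ t) := by
    intro s hs t ht
    simp only
    calc F₁ s * cellWt m₁ m₂ b₁ b₂ s * (F₂ t * cellWt m₁ m₂ b₁' b₂' t)
        = (F₁ s * F₂ t) * (cellWt m₁ m₂ b₁ b₂ s * cellWt m₁ m₂ b₁' b₂' t) := by ring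
      _ ≤ (F₃ (s ∩ t) * F₄ (s ∪ t)) *
            (cellWt m₁ m₂ (b₁ && b₁') (b₂ && b₂') (s ∩ t) *
              cellWt m₁ m₂ (b₁ || b₁') (b₂ || b₂') (s ∪ t)) := by
          apply mul_le_mul (h s hs t ht) (cellWt_mul_le m₁ m₂ b₁ b₂ b₁' b₂' s t)
          · exact mul_nonneg (cellWt_nonneg _ _ _ _ _) (cellWt_nonneg _ _ _ _ _)
          · exact mul_nonneg (h₃ _) (h₄ _)
      _ = F₃ (s ∩ t) * cellWt m₁ m₂ (b₁ && b₁') (b₂ && b₂') (s ∩ t) *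
            (F₄ (s ∪ t) * cellWt m₁ m₂ (b₁ || b₁') (b₂ || b₂') (s ∪ t)) := by ring
  have key := Finset.four_functions_theorem U g₁ g₂ g₃ g₄ hh
    (𝒜 := U.powerset) (ℬ := U.powerset) le_rfl le_rfl
  simpa only [Finset.powerset_infs_powerset_self, Finset.powerset_sups_powerset_self] using key

end CellBlock

section SureArc

variable {V : Type*} {E : Type*} [Fintype V] [DecidableEq V] [Fintype E] [DecidableEq E]
  {R : Type*} [Field R] [LinearOrder R] [IsStrictOrderedRing R]
  {arcs : E → Finset (V × V)} {s : V} {C : Finset V}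

/-- The head function of a closed-in core is nonnegative, decreasing and log-supermodular
(reversed van den Berg–Kahn) — `OrTailU.head_props` for a general core. -/
lemma core_head_props (pr : E → R) (hp : IsProbVec pr) (hS : SameEnds arcs) (t : V) :
    (∀ X : Finset V, 0 ≤ prob pr (coreAvoidEvent arcs s t C X)) ∧
    (∀ X Y : Finset V, X ⊆ Y →
      prob pr (coreAvoidEvent arcs s t C Y) ≤ prob pr (coreAvoidEvent arcs s t C X)) ∧
    (∀ X Y : Finset V,
      prob pr (coreAvoidEvent arcs s t C X) * prob pr (coreAvoidEvent arcs s t C Y) ≤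
      prob pr (coreAvoidEvent arcs s t C (X ∩ Y)) *
        prob pr (coreAvoidEvent arcs s t C (X ∪ Y))) := by
  refine ⟨fun X => prob_nonneg hp _, ?_, ?_⟩
  · intro X Y hXY
    apply prob_mono hp
    intro ω hω v hv
    exact hω v (Finset.insert_subset_insert s hXY hv)
  · intro X Y
    have hh := vdBKC_rev pr hp (sameEnds_coreOff (C := C) hS) t ∅ ∅ (insert s X) (insert s Y)
    have hi : insert s X ∩ insert s Y = insert s (X ∩ Y) :=
      (Finset.insert_inter_distrib X Y s).symm
    have hun : insert s X ∪ insert s Y = insert s (X ∪ Y) :=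
      (Finset.insert_union_distrib s X Y).symm
    rw [hi, hun] at hh
    simp only [coreAvoidEvent]
    simpa only [Finset.notMem_empty, false_imp_iff, implies_true, Set.setOf_true, Set.univ_inter,
      Finset.empty_union] using hh

/-- **THEOREM (row 2′DARC over a log-supermodular core with a SURE free-arc tail, any markers).**
`ClosedInCoreU arcs s C`, `SameEnds`, the cluster law log-supermodular (`hν`), `u ∈ C` sure
(`hsure : u ∉ W → P(level W) = 0`), markers `a, b ∈ C`, `t ∉ C`, `t ≠ s`, `w ≠ s`, `w ∉ C` ⟹
`Φ_D({s ↛ t in D + (u → w)}) ≥ 0`.  No non-degeneracy hypothesis. -/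
theorem darc_of_lsmCoreSure (pr : E → R) (hp : IsProbVec pr) (hS : SameEnds arcs)
    (h : ClosedInCoreU arcs s C) {t : V} (htC : t ∉ C) (hts : t ≠ s) {a b u w : V}
    (ha : a ∈ C) (hb : b ∈ C) (hu : u ∈ C) (hws : w ≠ s) (hwC : w ∉ C)
    (hν : ∀ W W', W ⊆ C → W' ⊆ C →
      prob pr (coreLevel arcs s C W) * prob pr (coreLevel arcs s C W') ≤
        prob pr (coreLevel arcs s C (W ∩ W')) * prob pr (coreLevel arcs s C (W ∪ W')))
    (hsure : ∀ W ⊆ C, u ∉ W → prob pr (coreLevel arcs s C W) = 0) :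
    DARC pr arcs s {t} a b u w := by
  unfold DARC
  rw [h.phiC_gate_eq pr hS htC hts ha hb hu hws hwC]
  obtain ⟨hA0, hAmono, hAlsm⟩ := core_head_props (C := C) (s := s) pr hp hS t
  set ν : Finset V → R := fun W => prob pr (coreLevel arcs s C W) with hνdef
  set A : Finset V → R := fun X => prob pr (coreAvoidEvent arcs s t C X) with hAdef
  set G : Finset V → R := fun W => A (starTarget u w W) with hGdef
  have hν0 : ∀ W, 0 ≤ ν W := fun W => prob_nonneg hp _
  have hG0 : ∀ W, 0 ≤ G W := fun W => hA0 _
  have hGA : ∀ W, G W ≤ A W := by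
    intro W
    simp only [hGdef, starTarget]
    split_ifs
    · exact hAmono _ _ (Finset.subset_insert _ _)
    · exact le_rfl
  -- the pointwise lattice steps, all one lsm step of `A`
  have hνA : ∀ s' ⊆ C, ∀ t' ⊆ C, ν s' * A s' * (ν t' * A t') ≤
      ν (s' ∩ t') * A (s' ∩ t') * (ν (s' ∪ t') * A (s' ∪ t')) := by
    intro s' hs' t' ht'
    calc ν s' * A s' * (ν t' * A t') = (ν s' * ν t') * (A s' * A t') := by ring
      _ ≤ (ν (s' ∩ t') * ν (s' ∪ t')) * (A (s' ∩ t') * A (s' ∪ t')) :=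
          mul_le_mul (hν s' t' hs' ht') (hAlsm s' t') (mul_nonneg (hA0 _) (hA0 _))
            (mul_nonneg (hν0 _) (hν0 _))
      _ = ν (s' ∩ t') * A (s' ∩ t') * (ν (s' ∪ t') * A (s' ∪ t')) := by ring
  -- on a cluster of positive weight `u` is present, so the gate value adds `w`
  have hGeq : ∀ W ⊆ C, ν W ≠ 0 → G W = A (insert w W) := by
    intro W hW hne
    have huW : u ∈ W := by
      by_contra huW
      exact hne (hsure W hW huW)
    simp only [hGdef, starTarget, huW, if_true]
  have hνG : ∀ s' ⊆ C, ∀ t' ⊆ C, ν s' * G s' * (ν t' * G t') ≤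
      ν (s' ∩ t') * G (s' ∩ t') * (ν (s' ∪ t') * G (s' ∪ t')) := by
    intro s' hs' t' ht'
    by_cases h1 : ν s' = 0
    · rw [h1]; simp only [zero_mul]
      exact mul_nonneg (mul_nonneg (hν0 _) (hG0 _)) (mul_nonneg (hν0 _) (hG0 _))
    by_cases h2 : ν t' = 0
    · rw [h2]; simp only [zero_mul, mul_zero]
      exact mul_nonneg (mul_nonneg (hν0 _) (hG0 _)) (mul_nonneg (hν0 _) (hG0 _))
    have hu1 : u ∈ s' := by
      by_contra hh; exact h1 (hsure s' hs' hh)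
    have hu2 : u ∈ t' := by
      by_contra hh; exact h2 (hsure t' ht' hh)
    have e1 := hGeq s' hs' h1
    have e2 := hGeq t' ht' h2
    have e3 : G (s' ∩ t') = A (insert w (s' ∩ t')) := by
      simp only [hGdef, starTarget, Finset.mem_inter, hu1, hu2, and_self, if_true]
    have e4 : G (s' ∪ t') = A (insert w (s' ∪ t')) := by
      simp only [hGdef, starTarget, Finset.mem_union, hu1, true_or, if_true]
    rw [e1, e2, e3, e4]
    have hI : insert w s' ∩ insert w t' = insert w (s' ∩ t') :=
      (Finset.insert_inter_distrib s' t' w).symm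
    have hU : insert w s' ∪ insert w t' = insert w (s' ∪ t') :=
      (Finset.insert_union_distrib w s' t').symm
    have hl := hAlsm (insert w s') (insert w t')
    rw [hI, hU] at hl
    calc ν s' * A (insert w s') * (ν t' * A (insert w t'))
        = (ν s' * ν t') * (A (insert w s') * A (insert w t')) := by ring
      _ ≤ (ν (s' ∩ t') * ν (s' ∪ t')) * (A (insert w (s' ∩ t')) * A (insert w (s' ∪ t'))) :=
          mul_le_mul (hν s' t' hs' ht') hl (mul_nonneg (hA0 _) (hA0 _))
            (mul_nonneg (hν0 _) (hν0 _))
      _ = ν (s' ∩ t') * A (insert w (s' ∩ t')) * (ν (s' ∪ t') * A (insert w (s' ∪ t'))) := by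
          ring
  -- the mixed step: gate on the left factor, gate on the join
  have hνGA : ∀ s' ⊆ C, ∀ t' ⊆ C, ν s' * G s' * (ν t' * A t') ≤
      ν (s' ∩ t') * A (s' ∩ t') * (ν (s' ∪ t') * G (s' ∪ t')) := by
    intro s' hs' t' ht'
    by_cases h1 : ν s' = 0
    · rw [h1]; simp only [zero_mul]
      exact mul_nonneg (mul_nonneg (hν0 _) (hA0 _)) (mul_nonneg (hν0 _) (hG0 _))
    have hu1 : u ∈ s' := by
      by_contra hh; exact h1 (hsure s' hs' hh)
    have e1 := hGeq s' hs' h1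
    have e4 : G (s' ∪ t') = A (insert w (s' ∪ t')) := by
      simp only [hGdef, starTarget, Finset.mem_union, hu1, true_or, if_true]
    rw [e1, e4]
    have hwt : w ∉ t' := fun hw => hwC (ht' hw)
    have hI : insert w s' ∩ t' = s' ∩ t' := by
      ext x
      simp only [Finset.mem_inter, Finset.mem_insert]
      constructor
      · rintro ⟨hx | hx, hxt⟩
        · exact absurd (hx ▸ hxt) hwt
        · exact ⟨hx, hxt⟩
      · rintro ⟨hx, hxt⟩; exact ⟨Or.inr hx, hxt⟩
    have hU : insert w s' ∪ t' = insert w (s' ∪ t') := Finset.insert_union w s' t'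
    have hl := hAlsm (insert w s') t'
    rw [hI, hU] at hl
    calc ν s' * A (insert w s') * (ν t' * A t')
        = (ν s' * ν t') * (A (insert w s') * A t') := by ring
      _ ≤ (ν (s' ∩ t') * ν (s' ∪ t')) * (A (s' ∩ t') * A (insert w (s' ∪ t'))) :=
          mul_le_mul (hν s' t' hs' ht') hl (mul_nonneg (hA0 _) (hA0 _))
            (mul_nonneg (hν0 _) (hν0 _))
      _ = ν (s' ∩ t') * A (s' ∩ t') * (ν (s' ∪ t') * A (insert w (s' ∪ t'))) := by ring
  have hνA0 : ∀ W, 0 ≤ ν W * A W := fun W => mul_nonneg (hν0 W) (hA0 W)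
  have hνG0 : ∀ W, 0 ≤ ν W * G W := fun W => mul_nonneg (hν0 W) (hG0 W)
  -- the block sums
  set L : Bool → Bool → R := fun b₁ b₂ => ∑ W ∈ C.powerset, ν W * A W * cellWt a b b₁ b₂ W
    with hLdef
  set M : Bool → Bool → R := fun b₁ b₂ => ∑ W ∈ C.powerset, ν W * G W * cellWt a b b₁ b₂ W
    with hMdef
  have hL0 : ∀ b₁ b₂, 0 ≤ L b₁ b₂ := fun b₁ b₂ =>
    Finset.sum_nonneg fun W _ => mul_nonneg (hνA0 W) (cellWt_nonneg _ _ _ _ _)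
  have hM0 : ∀ b₁ b₂, 0 ≤ M b₁ b₂ := fun b₁ b₂ =>
    Finset.sum_nonneg fun W _ => mul_nonneg (hνG0 W) (cellWt_nonneg _ _ _ _ _)
  have hML : ∀ b₁ b₂, M b₁ b₂ ≤ L b₁ b₂ := fun b₁ b₂ =>
    Finset.sum_le_sum fun W _ =>
      mul_le_mul_of_nonneg_right
        (mul_le_mul_of_nonneg_left (hGA W) (hν0 W)) (cellWt_nonneg _ _ _ _ _)
  have AD := fun (F₁ F₂ F₃ F₄ : Finset V → R) h₁ h₂ h₃ h₄ hh b₁ b₂ b₁' b₂' =>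
    cellBlock_mul_le C F₁ F₂ F₃ F₄ a b b₁ b₂ b₁' b₂' h₁ h₂ h₃ h₄ hh
  have H1 : L true false * L false true ≤ L false false * L true true := by
    have := AD (fun W => ν W * A W) (fun W => ν W * A W) (fun W => ν W * A W)
      (fun W => ν W * A W) hνA0 hνA0 hνA0 hνA0 hνA true false false true
    simpa only [Bool.true_and, Bool.and_true, Bool.false_or, Bool.or_false] using this
  have H2 : M true false * M false true ≤ M false false * M true true := by
    have := AD (fun W => ν W * G W) (fun W => ν W * G W) (fun W => ν W * G W)
      (fun W => ν W * G W) hνG0 hνG0 hνG0 hνG0 hνG true false false true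
    simpa only [Bool.true_and, Bool.and_true, Bool.false_or, Bool.or_false] using this
  have G1 : M false false * L true false ≤ L false false * M true false := by
    have := AD (fun W => ν W * G W) (fun W => ν W * A W) (fun W => ν W * A W)
      (fun W => ν W * G W) hνG0 hνA0 hνA0 hνG0 hνGA false false true false
    simpa only [Bool.false_and, Bool.false_or] using this
  have G2 : M false false * L false true ≤ L false false * M false true := by
    have := AD (fun W => ν W * G W) (fun W => ν W * A W) (fun W => ν W * A W)
      (fun W => ν W * G W) hνG0 hνA0 hνA0 hνG0 hνGA false false false true
    simpa only [Bool.false_and, Bool.false_or] using this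
  have G3 : M true false * L true true ≤ L true false * M true true := by
    have := AD (fun W => ν W * G W) (fun W => ν W * A W) (fun W => ν W * A W)
      (fun W => ν W * G W) hνG0 hνA0 hνA0 hνG0 hνGA true false true true
    simpa only [Bool.true_and, Bool.false_and, Bool.true_or, Bool.false_or] using this
  have G4 : M false true * L true true ≤ L false true * M true true := by
    have := AD (fun W => ν W * G W) (fun W => ν W * A W) (fun W => ν W * A W)
      (fun W => ν W * G W) hνG0 hνA0 hνA0 hνG0 hνGA false true true true
    simpa only [Bool.false_and, Bool.true_and, Bool.false_or, Bool.true_or] using this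
  have G5 : M false false * L true true ≤ L false false * M true true := by
    have := AD (fun W => ν W * G W) (fun W => ν W * A W) (fun W => ν W * A W)
      (fun W => ν W * G W) hνG0 hνA0 hνA0 hνG0 hνGA false false true true
    simpa only [Bool.false_and, Bool.false_or] using this
  -- the seven moments as block sums
  have eΛ := sum_split_four C (fun W => ν W * A W) a b
  have eFa := sum_split_fst C (fun W => ν W * A W) a b
  have eFb := sum_split_snd C (fun W => ν W * A W) a b
  have eM := sum_split_four C (fun W => ν W * G W) a b
  have eX := sum_split_fst C (fun W => ν W * G W) a b
  have eY := sum_split_snd C (fun W => ν W * G W) a b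
  have eXY := sum_split_both C (fun W => ν W * G W) a b
  have key := blockII_nonneg (L false false) (L false true) (L true false) (L true true)
    (M false false) (M false true) (M true false) (M true true)
    (hL0 _ _) (hL0 _ _) (hL0 _ _) (hL0 _ _) (hM0 _ _) (hM0 _ _) (hM0 _ _) (hM0 _ _)
    (hML _ _) (hML _ _) (hML _ _) (hML _ _) H1 H2 G1 G2 G3 G4 G5
  simp only [hLdef, hMdef] at key
  simp only [hνdef, hAdef, hGdef] at key eΛ eFa eFb eM eX eY eXY
  rw [eΛ, eFa, eFb, eM, eX, eY, eXY]
  exact key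

end SureArc

end Summit.Ventures.PercRepro2.Coin
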